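import Literature.AlgebraicGeometry.Motives.HodgeStructureLefschetzGroupPowersExteriorInvariants
import Literature.AlgebraicGeometry.Motives.HodgeStructureLefschetzGroupInvariantsRational
import HarnessLib

/-!
# Milne 1999, Thm. 3.2 WITH RATIONAL COEFFICIENTS FOR ALL POWERS `r ≥ 1`: the rational classes of `⋀_ℚ(V^{⊕ι})` fixed,
# after `⊗ ℂ`, by the DIAGONAL action of `S(H₀)(ℂ)` are generated over `ℚ` by the rational divisor `2`-vectors of `H₀^{⊕ι}`;
# `toComplexAlg` is injective

[topic AlgebraicGeometry/Motives]

Layer `Literature/AlgebraicGeometry/Motives`, lane `lit-hodgefound` (Track 2 foundations library; seat `lit-hodgefound-p34`,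
generation 25, self-proposed row g25-#7 of `run/shared/lean/pub/lit-hodgefound/SKELETON.md`). THEOREMS ONLY (no definition,
no named fact; net debt `0`). CARRIER: a polarized pure `ℚ`-Hodge structure `(H₀, Q₀)` of odd weight on `V`, its power
`H₀^{⊕ι}` on `ι → V` (`HodgeStructure.pi`, `Polarization.pi`, a finite nonempty `ι`, "`A^r`"), the diagonal
`Δ : GL(K ⊗ V) → GL(K ⊗ V^{⊕ι})` (`piDiagEmbedding`, g19), the exterior algebra `⋀_ℚ (ι → V)` with RATIONAL coefficients and
p02's `Θ = toComplexAlg (ι → V) : ⋀_ℚ → ⋀_ℂ` (`x ↦ x ⊗ 1`). This file is the conjunction of the seat's g25-#4 (powers, `K`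
algebraically closed) and g25-#6 (descent to `ℚ`, `r = 1`): Thm. 3.2 for the Betti theory (`k = ℚ`) and every `r ≥ 1`.

## The source, verbatim

J. S. Milne, *Lefschetz classes on abelian varieties*, Duke Math. J. **96** (1999) 639–675 [Milne1999LefschetzClasses] (held
`paper:doi-10-1215-s0012-7094-99-09620-5` p0015 L18–L27, p. 653; p0014 L78–L91, p. 652): "From the canonical isomorphisms
`H¹(A) = V(A)^∨`, `H¹(A^r) ≅ rH¹(A)`, `H*(A^r) ≅ ⋀ H¹(A^r)`, we obtain an action of `S(A)` on `H*(A^r)` for all `r`. […]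
**Theorem 3.2.** For any abelian variety `A` over `Ω` and integer `r ≥ 0`, the `k`-algebra `H*(A^r)^{S(A)}` is generated by
divisor classes."; p. 652: "`V^G` is the space of vectors in `V` fixed by the elements of `G(k)` [when `G(k)` is dense] …
**Lemma 3.1.** … `(V^G) ⊗_k k^{al} = (V ⊗_k k^{al})^{G_{k^{al}}}`"; §1 Prop. 1.5 / §3 p. 654 L16–L17: "`S(A) = S(A^r)`". N.
Bourbaki, *Algèbre* Ch. III [BourbakiAlgebre1a3] §7 no. 5 Prop. 8: `k' ⊗_k ⋀(M) ≅ ⋀(k' ⊗_k M)`.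

## What is PROVED (`Θ = toComplexAlg`, `D_ℚ` the rational divisor `2`-vectors of `(H₀^{⊕ι}, Q₀^{⊕ι})` as in g25-#6)

* §1 **`ExteriorLefschetz.toComplexAlg_injective`** (`Θ : ⋀_ℚ V → ⋀_ℂ (ℂ ⊗ V)` is injective: degree by degree it is the
  bijective canonical base change on `1 ⊗ ⋀ᵏ_ℚ V`), `Polarization.eq_zero_of_forall_lefschetzGroupBaseChange_map_toComplexAlg_eq_of_odd`
  (no odd-degree rational invariants, `r = 1`).
* §2 POWERS, rational coefficients (`x ∈ ⋀_ℚ (ι → V)`, invariance of `Θ x` under `⋀(Δγ₀)`, `γ₀ ∈ S(H₀)(ℂ)`):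
  **`Polarization.setOf_mem_and_forall_piDiagEmbedding_map_toComplexAlg_eq_eq_span_pow`** ("`H^{2p}(A^r, ℚ)^{S(A)} =
  D^p(A^r)_ℚ`": `= (span_ℚ D_ℚ)^p` on `⋀[ℚ]^{2p}`), **`Polarization.setOf_forall_piDiagEmbedding_map_toComplexAlg_eq_eq_adjoin`**
  ("the `ℚ`-algebra `H*(A^r, ℚ)^{S(A)}` is generated by divisor classes": `= ℚ[D_ℚ]`), the membership forms
  `Polarization.mem_span_divisorTwoVectors_pow_of_forall_piDiagEmbedding_map_toComplexAlg_eq`,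
  `Polarization.mem_adjoin_divisorTwoVectors_of_forall_piDiagEmbedding_map_toComplexAlg_eq`, and
  `Polarization.eq_zero_of_forall_piDiagEmbedding_map_toComplexAlg_eq_of_odd` (odd degrees).

## Lean encoding, differences

As in g25-#4/#6: `S(A)` acts on `H*(A^r)` through the diagonal, "fixed by `S(A)`" for a rational class means `Θ x` fixed by
`S(H₀)(ℂ)`; odd weight; `ι` finite and nonempty (`r ≥ 1`; `r = 0` is `⋀ 0 = ℚ`).

## References
* [Milne1999LefschetzClasses] J. S. Milne, *Lefschetz classes on abelian varieties*, Duke Math. J. 96 (1999), Lemma 3.1 (p. 652),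
  Thm. 3.2 (p. 653), Prop. 1.5, §3 p. 654.
* [BourbakiAlgebre1a3] N. Bourbaki, *Algèbre* Ch. III §7 no. 5 Prop. 8.
-/

open scoped TensorProduct
open DirectSum

namespace Literature.AlgebraicGeometry.Motives

/-! ### §1 `toComplexAlg` is injective; no odd rational invariants -/

namespace ExteriorLefschetz

universe u

variable (V : Type u) [AddCommGroup V] [Module ℚ V]

/-- **`Θ = toComplexAlg V : ⋀_ℚ V → ⋀_ℂ (ℂ ⊗ V)` is injective** (`ℂ ⊗_ℚ ⋀_ℚ V ≅ ⋀_ℂ(ℂ ⊗ V)` and `ℚ → ℂ` is flat: degree by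
degree `Θ` is the bijective canonical base change on `1 ⊗ ⋀ᵏ_ℚ V`, and `Θ` respects the grading).
[cite: BourbakiAlgebre1a3, Ch. III §7 no. 5 Prop. 8] -/
theorem toComplexAlg_injective : Function.Injective (toComplexAlg V) := by
  classical
  refine (injective_iff_map_eq_zero _).2 fun x hx ↦ ?_
  rw [← sum_support_decompose (fun i : ℕ => ⋀[ℚ]^i V) x]
  refine Finset.sum_eq_zero fun i _ ↦ ?_
  have h0 : toComplexAlg V ((decompose (fun i : ℕ => ⋀[ℚ]^i V) x i : ⋀[ℚ]^i V) : ExteriorAlgebra ℚ V) = 0 := by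
    rw [← coe_decompose_toComplexAlg, hx, decompose_zero, DirectSum.zero_apply, ZeroMemClass.coe_zero]
  have hbot : ((decompose (fun i : ℕ => ⋀[ℚ]^i V) x i : ⋀[ℚ]^i V) : ExteriorAlgebra ℚ V) ∈
      (⊥ : Submodule ℚ (ExteriorAlgebra ℚ V)) :=
    mem_of_toComplexAlg_mem_span_image V bot_le (decompose (fun i : ℕ => ⋀[ℚ]^i V) x i).2
      (by rw [h0]; exact Submodule.zero_mem _)
  exact (Submodule.mem_bot ℚ).1 hbot

end ExteriorLefschetz

namespace HodgeStructure

open ExteriorLefschetz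

universe u

section One

variable {V : Type u} [AddCommGroup V] [Module ℚ V] {n : ℤ} {H : HodgeStructure V n} (Q : Polarization H)

/-- **No odd-degree rational invariants** (`r = 1`): a rational `x ∈ ⋀[ℚ]^m V`, `m` odd, with `Θ x` fixed by `S(H)(ℂ)` is `0`
(`−1 ∈ S(H)(ℂ)` kills `Θ x`, and `Θ` is injective). [cite: Milne1999LefschetzClasses, §3 p. 654] -/
theorem Polarization.eq_zero_of_forall_lefschetzGroupBaseChange_map_toComplexAlg_eq_of_odd {m : ℕ} (hm : Odd m)
    {x : ExteriorAlgebra ℚ V} (hxm : x ∈ ⋀[ℚ]^m V)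
    (hx : ∀ γ ∈ Q.lefschetzGroupBaseChange ℂ,
      ExteriorAlgebra.map (γ : (ℂ ⊗[ℚ] V) →ₗ[ℂ] (ℂ ⊗[ℚ] V)) (toComplexAlg V x) = toComplexAlg V x) : x = 0 :=
  toComplexAlg_injective V (by
    rw [map_zero]
    exact Q.eq_zero_of_forall_lefschetzGroupBaseChange_map_eq_of_odd ℂ hm (toComplexAlg_mem V hxm) hx)

end One

/-! ### §2 Powers `r ≥ 1` with rational coefficients -/

section Powers

variable {ι : Type} [Fintype ι] [DecidableEq ι] [Nonempty ι] {V : Type u} [AddCommGroup V] [Module ℚ V] [Module.Finite ℚ V]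
  {n : ℤ} {H₀ : HodgeStructure V n} (Q₀ : Polarization H₀)

/-- **Milne 1999, Thm. 3.2 DEGREEWISE for `A^r`, rational coefficients: "`H^{2p}(A^r, ℚ)^{S(A)} = D^p(A^r)_ℚ`"** — a rational
`x ∈ ⋀[ℚ]^{2p}(V^{⊕ι})` has `Θ x` fixed by the diagonal action of every `γ₀ ∈ S(H₀)(ℂ)` iff `x ∈ (span_ℚ D_ℚ)^p`, `D_ℚ` the
rational divisor `2`-vectors of `(H₀^{⊕ι}, Q₀^{⊕ι})` ("`S(A) = S(A^r)`", Prop. 1.5, then g25-#6 for `H₀^{⊕ι}`).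
[cite: Milne1999LefschetzClasses, Lemma 3.1 (p. 652), Thm. 3.2 (p. 653), Prop. 1.5, §3 p. 654 L16–L17] -/
theorem Polarization.setOf_mem_and_forall_piDiagEmbedding_map_toComplexAlg_eq_eq_span_pow (hn : Odd n) (p : ℕ) :
    {x : ExteriorAlgebra ℚ (ι → V) | x ∈ ⋀[ℚ]^(2 * p) (ι → V) ∧ ∀ γ₀ ∈ Q₀.lefschetzGroupBaseChange ℂ,
        ExteriorAlgebra.map (piDiagEmbedding ℂ V ι γ₀ : (ℂ ⊗[ℚ] (ι → V)) →ₗ[ℂ] (ℂ ⊗[ℚ] (ι → V)))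
          (toComplexAlg (ι → V) x) = toComplexAlg (ι → V) x} =
      ↑(Submodule.span ℚ {y : ExteriorAlgebra ℚ (ι → V) | y ∈ ⋀[ℚ]^2 (ι → V) ∧
        ∃ a ∈ (HodgeStructure.pi fun _ : ι ↦ H₀).endAlg, (Polarization.pi fun _ : ι ↦ Q₀).adjoint a = a ∧
          ∀ v w, contractionForm y ((Polarization.pi fun _ : ι ↦ Q₀).form v) ((Polarization.pi fun _ : ι ↦ Q₀).form w) =
            (Polarization.pi fun _ : ι ↦ Q₀).form (a v) w} ^ p) := by
  rw [← (Polarization.pi fun _ : ι ↦ Q₀).setOf_mem_and_forall_lefschetzGroupBaseChange_map_toComplexAlg_eq_eq_span_pow hn p]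
  ext x
  simp only [Set.mem_setOf_eq, Polarization.forall_piDiagEmbedding_map_eq_iff ℂ Q₀]

/-- Membership form: `x ∈ ⋀[ℚ]^{2p}(V^{⊕ι})` with `Θ x` fixed by the diagonal `S(H₀)(ℂ)` lies in `(span_ℚ D_ℚ)^p`.
[cite: Milne1999LefschetzClasses, Thm. 3.2 (p. 653), §3 p. 654 L16–L17] -/
theorem Polarization.mem_span_divisorTwoVectors_pow_of_forall_piDiagEmbedding_map_toComplexAlg_eq (hn : Odd n) {p : ℕ}
    {x : ExteriorAlgebra ℚ (ι → V)} (hxm : x ∈ ⋀[ℚ]^(2 * p) (ι → V))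
    (hx : ∀ γ₀ ∈ Q₀.lefschetzGroupBaseChange ℂ,
      ExteriorAlgebra.map (piDiagEmbedding ℂ V ι γ₀ : (ℂ ⊗[ℚ] (ι → V)) →ₗ[ℂ] (ℂ ⊗[ℚ] (ι → V)))
        (toComplexAlg (ι → V) x) = toComplexAlg (ι → V) x) :
    x ∈ Submodule.span ℚ {y : ExteriorAlgebra ℚ (ι → V) | y ∈ ⋀[ℚ]^2 (ι → V) ∧
        ∃ a ∈ (HodgeStructure.pi fun _ : ι ↦ H₀).endAlg, (Polarization.pi fun _ : ι ↦ Q₀).adjoint a = a ∧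
          ∀ v w, contractionForm y ((Polarization.pi fun _ : ι ↦ Q₀).form v) ((Polarization.pi fun _ : ι ↦ Q₀).form w) =
            (Polarization.pi fun _ : ι ↦ Q₀).form (a v) w} ^ p := by
  have h : x ∈ {x : ExteriorAlgebra ℚ (ι → V) | x ∈ ⋀[ℚ]^(2 * p) (ι → V) ∧ ∀ γ₀ ∈ Q₀.lefschetzGroupBaseChange ℂ,
      ExteriorAlgebra.map (piDiagEmbedding ℂ V ι γ₀ : (ℂ ⊗[ℚ] (ι → V)) →ₗ[ℂ] (ℂ ⊗[ℚ] (ι → V)))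
        (toComplexAlg (ι → V) x) = toComplexAlg (ι → V) x} := ⟨hxm, hx⟩
  rw [Q₀.setOf_mem_and_forall_piDiagEmbedding_map_toComplexAlg_eq_eq_span_pow hn p] at h
  exact h

/-- **Milne 1999, Thm. 3.2 for `A^r` with rational coefficients, whole algebra: "the `ℚ`-algebra `H*(A^r, ℚ)^{S(A)}` is
generated by divisor classes"** — the rational classes of `⋀_ℚ(V^{⊕ι})` whose complexification is fixed by the diagonal
`S(H₀)(ℂ)` form exactly `ℚ[D_ℚ]`. [cite: Milne1999LefschetzClasses, Lemma 3.1 (p. 652), Thm. 3.2 (p. 653), §3 p. 654 L16–L17] -/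
theorem Polarization.setOf_forall_piDiagEmbedding_map_toComplexAlg_eq_eq_adjoin (hn : Odd n) :
    {x : ExteriorAlgebra ℚ (ι → V) | ∀ γ₀ ∈ Q₀.lefschetzGroupBaseChange ℂ,
        ExteriorAlgebra.map (piDiagEmbedding ℂ V ι γ₀ : (ℂ ⊗[ℚ] (ι → V)) →ₗ[ℂ] (ℂ ⊗[ℚ] (ι → V)))
          (toComplexAlg (ι → V) x) = toComplexAlg (ι → V) x} =
      ↑(Algebra.adjoin ℚ {y : ExteriorAlgebra ℚ (ι → V) | y ∈ ⋀[ℚ]^2 (ι → V) ∧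
        ∃ a ∈ (HodgeStructure.pi fun _ : ι ↦ H₀).endAlg, (Polarization.pi fun _ : ι ↦ Q₀).adjoint a = a ∧
          ∀ v w, contractionForm y ((Polarization.pi fun _ : ι ↦ Q₀).form v) ((Polarization.pi fun _ : ι ↦ Q₀).form w) =
            (Polarization.pi fun _ : ι ↦ Q₀).form (a v) w}) := by
  rw [← (Polarization.pi fun _ : ι ↦ Q₀).setOf_forall_lefschetzGroupBaseChange_map_toComplexAlg_eq_eq_adjoin hn]
  ext x
  simp only [Set.mem_setOf_eq, Polarization.forall_piDiagEmbedding_map_eq_iff ℂ Q₀]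

/-- Membership form: a rational class of `⋀_ℚ(V^{⊕ι})` with `Θ x` fixed by the diagonal `S(H₀)(ℂ)` is a polynomial over `ℚ`
in rational divisor `2`-vectors. [cite: Milne1999LefschetzClasses, Thm. 3.2 (p. 653), §3 p. 654 L16–L17] -/
theorem Polarization.mem_adjoin_divisorTwoVectors_of_forall_piDiagEmbedding_map_toComplexAlg_eq (hn : Odd n)
    {x : ExteriorAlgebra ℚ (ι → V)}
    (hx : ∀ γ₀ ∈ Q₀.lefschetzGroupBaseChange ℂ,
      ExteriorAlgebra.map (piDiagEmbedding ℂ V ι γ₀ : (ℂ ⊗[ℚ] (ι → V)) →ₗ[ℂ] (ℂ ⊗[ℚ] (ι → V)))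
        (toComplexAlg (ι → V) x) = toComplexAlg (ι → V) x) :
    x ∈ Algebra.adjoin ℚ {y : ExteriorAlgebra ℚ (ι → V) | y ∈ ⋀[ℚ]^2 (ι → V) ∧
        ∃ a ∈ (HodgeStructure.pi fun _ : ι ↦ H₀).endAlg, (Polarization.pi fun _ : ι ↦ Q₀).adjoint a = a ∧
          ∀ v w, contractionForm y ((Polarization.pi fun _ : ι ↦ Q₀).form v) ((Polarization.pi fun _ : ι ↦ Q₀).form w) =
            (Polarization.pi fun _ : ι ↦ Q₀).form (a v) w} := by
  have h : x ∈ {x : ExteriorAlgebra ℚ (ι → V) | ∀ γ₀ ∈ Q₀.lefschetzGroupBaseChange ℂ,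
      ExteriorAlgebra.map (piDiagEmbedding ℂ V ι γ₀ : (ℂ ⊗[ℚ] (ι → V)) →ₗ[ℂ] (ℂ ⊗[ℚ] (ι → V)))
        (toComplexAlg (ι → V) x) = toComplexAlg (ι → V) x} := hx
  rw [Q₀.setOf_forall_piDiagEmbedding_map_toComplexAlg_eq_eq_adjoin hn] at h
  exact h

omit [Module.Finite ℚ V] in
/-- **No odd-degree rational invariants of the diagonal action** (`Δ(−1) = −1`; `Θ` injective).
[cite: Milne1999LefschetzClasses, §3 p. 654] -/
theorem Polarization.eq_zero_of_forall_piDiagEmbedding_map_toComplexAlg_eq_of_odd {m : ℕ} (hm : Odd m)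
    {x : ExteriorAlgebra ℚ (ι → V)} (hxm : x ∈ ⋀[ℚ]^m (ι → V))
    (hx : ∀ γ₀ ∈ Q₀.lefschetzGroupBaseChange ℂ,
      ExteriorAlgebra.map (piDiagEmbedding ℂ V ι γ₀ : (ℂ ⊗[ℚ] (ι → V)) →ₗ[ℂ] (ℂ ⊗[ℚ] (ι → V)))
        (toComplexAlg (ι → V) x) = toComplexAlg (ι → V) x) : x = 0 :=
  toComplexAlg_injective (ι → V) (by
    rw [map_zero]
    exact Q₀.eq_zero_of_forall_piDiagEmbedding_map_eq_of_odd ℂ hm (toComplexAlg_mem (ι → V) hxm) hx)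

end Powers

end HodgeStructure

end Literature.AlgebraicGeometry.Motives
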